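import Mathlib
import HarnessLib
import Summits.HubbardSuperconductivity.HubbardSuperconductivity.Theorems.KLProgrammeKLRegimeEngineIsoBoxNearFarRegime
import Summits.HubbardSuperconductivity.HubbardSuperconductivity.Theorems.KLProgrammeKLRegimeEngineIsoTuplePatterns
import Summits.HubbardSuperconductivity.HubbardSuperconductivity.Theorems.KLProgrammeH10TwoPointLimitIsoTorusRates
import Summits.HubbardSuperconductivity.HubbardSuperconductivity.Theorems.KLProgrammeKLRegimeSplitThermalLayer
import Summits.HubbardSuperconductivity.HubbardSuperconductivity.Theorems.KLProgrammeKLRegimeEngineSymbolThresholds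
import Summits.HubbardSuperconductivity.HubbardSuperconductivity.Theorems.KLProgrammeKLRegimeEngineThresholdBridges
import Summits.HubbardSuperconductivity.HubbardSuperconductivity.Theorems.KLProgrammeKLRegimeEngineIsoTupleExportWCloser
import Summits.HubbardSuperconductivity.HubbardSuperconductivity.Theorems.KLProgrammeKLRegimeEngineIsoTupleV17FDoor

/-!
# Route `KLProgramme` — ENGINE item stmt-HubbardSuperconductivity-20437, class #6 / (E5-F)ₙ producer, route (M): THE M3 ASSEMBLY MODULO M2 —
# the iso fixed-tuple line of `𝒱ₙ[K]` at EVERY resolution `m ≥ n`, EVERY label 4-tuple and pin, from the `↑↓` VALUE bound `B` on `klBall L μ 0` and the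
# scale-weighted pinned FIRST MOMENTS `X` of the standard iso tuples: `fixedTupleL1 ≤ A·(B + X)` with ONE absolute `A`, under the engine's stub binders

Cell gate-hubbard-kl, seat hubbard-kl-k3c2-p2 (g12; owner-designate of M1 + M3 of route (M), pen (R59az)).  Composition, no new estimate: the regime shape
`fixedTupleL1_klIsoKernelAt_le_regime` (…EngineIsoBoxNearFarRegime, p578483; near radius `ρ := 1`), the thermal facts `π/β ≤ Λ_{n_β} ≤ Λ_m` (`m ≤ n_β`,
…SplitThermalLayer) and `klIsoFamily ≡ 0` for `m > n_β` (…IsoTorusRates), and the pattern reduction `fixedTupleL1_klIsoKernelAt_le_two_mul_of_std`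
(…EngineIsoTuplePatterns: every spin/charge pattern from the standard one `(+↑,−↑,+↓,−↓)`, factor `2`).

* §1 `fixedTupleL1_klIsoKernelAt_eq_zero_of_nScales_lt` — inactive resolutions `m > n_β`: the class-#6 size is `0` (no Matsubara frequency below `Λ_m < π/β`).
* §2 **`fixedTupleL1_klIsoKernelAt_le_regime_allPatterns`** — `∃ A ≥ 1` absolute: under the symbol-layer thresholds (`c`, `U`, `β`, `μ ∈ klWindowC`, `FrameOK`, `L ≥ β²`, `M ≥ β`),
  for every kernel scale `n`, resolution `m ≥ 1`, value bound `B ≥ 0` (`‖klQuarticValue … K n 0 1 k₁ k₂ k₃‖ ≤ B` on `klBall L μ 0`) and moment budget `X ≥ 0`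
  (`Λ_m·ε³Σ_y spaceTimeDist x₁ (y j)·‖klIsoKernelAt … n m Ω_std (x₁::y)‖ ≤ X` for the STANDARD tuples, all sector strings, pins, `j < 3` — asked only when `m ≤ n_β`):
  `fixedTupleL1 β 3 (klIsoKernelAt … K n m) Ω x₁ ≤ A·(B + X)` for EVERY `Ω` and `x₁`.
* §3 **`fixedTupleL1_klIsoKernelAt_le_valueMoments_klEng`** — the same under the engine's STUB BINDERS (`c ≤ klEngC₃3 P R`, `U ≤ klEngU₀3 P R c`, `klEngL₃ β U ≤ L`, `klEngM₃ β U L ≤ M`, `R.WF2`)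
  by this cell's threshold bridges (`klEngC₃3_le_symbolC₃`, `klEngU₀3_le_symbolU₀`, `sq_le_of_klEngL₃_le`, `le_of_klEngM₃_le`).
* §4 PACKAGINGS for the two consumers: **`isoTupleLineAt_of_valueLine_momentLine`** (an outright value line `≤ c_B·U` at scale `n` and a moment line
  `X = c_M·U + c_M′·(Klam U)²` give `IsoTupleLineAt L M (A(c_B + c_M)) (A c_M′) P β U μ n` — the class-#6 text of (X).2), and **`isoTupleL1AtV17F_of_momentLine_of_lowValue`**
  ((E5-F)ₙ in its `∀ B` form from the moment line and ONE value LOWER bound `θ·U ≤ ‖λ_n[K_n]‖` on the ball — the B-absorption of `isoTupleL1AtV17F_of_fixedTuple_le` — when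
  `A(1 + c_M/θ) ≤ CF`, `A c_M′ ≤ CF`).
* §5 **`exists_isoPkgW_of_valueLine_momentLine`** — the (X).2 conjunct `∃ e, IsIsoPkgW P CF e ∧ IsoTupleLineStepW P R Q e.1 e.2.1 e.2.2` from the value line, the
  moment line and the fit of `(A(c_B + c_M), A c_M′, u)` against `CF` (`exists_isoPkgW_of_isoLine` of …IsoTupleExportWCloser ∘ §4).
* §6 (appended) **`fixedTupleL1_klIsoKernelAt_le_regime_allPatterns_rho`** — the same with the near radius `ρ` free: `≤ 2((C(ρ+1/128)³)³(B/24 + 6X) + 3X/ρ)` ((R1) tuning).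

WHAT IS LEFT for route (M) after this file, by name: M2 = the moment line (the (E4-iso)ₙ datum: `Λ_m × ` the three pinned first moments of the STANDARD iso tuples of `𝒱ₙ[K_n]` at
resolutions `n ≤ m ≤ n_β`, W3 owners); the value input (child 1's line / the value lane's telescoped bound); the fit of `A` against `CF` ((R1), T+).  Everything is proved;
no definitions; nothing about the model is asserted beyond these implications.  References: BGM 2006 §2.7 (2.69)–(2.71a), §2.8 (2.77) [cite: BenfattoGiulianiMastropietro2006].
-/

noncomputable section

namespace Summit.HubbardSuperconductivity.HubbardSuperconductivity.Theorems.EngineV8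

set_option linter.dupNamespace false -- summit = problem name (single-conjunct summit), D-0017

open Set Finset Literature.MathematicalPhysics.QuantumLattice Literature.MathematicalPhysics.QuantumLattice.BandSectorCounting
open Literature.MathematicalPhysics.QuantumLattice.FermiRG Literature.Probability.LatticeModels Literature.Analysis.SpecialFunctions
open Summit.HubbardSuperconductivity.HubbardSuperconductivity.Theorems.DispersionFlow
open Summit.HubbardSuperconductivity.HubbardSuperconductivity.Theorems.KLRegimeSplit
open Summit.HubbardSuperconductivity.HubbardSuperconductivity.Theorems.KLProgrammeLegKernels
open Summit.HubbardSuperconductivity.HubbardSuperconductivity.Theorems.PerturbedFermiCurve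
open Summit.HubbardSuperconductivity.HubbardSuperconductivity.Theorems.TorusFourierL2
open scoped Real

open Classical

/-! ## §1 Inactive resolutions -/

section Inactive

variable {L M : ℕ} [NeZero L] [NeZero M]

omit [NeZero M] in
/-- **Beyond the temperature scale the class-#6 size vanishes**: for `m > n_β` (`Λ_m < π/β`, `klth_klScale_lt_pi_div`) the iso multipliers are `≡ 0` on the Matsubara grid
(`klIsoFamily_eq_zero_of_klScale_lt`), hence so are the sectorised kernels and `fixedTupleL1 β 3 (klIsoKernelAt … K n m) Ω x₁ = 0`. -/
theorem fixedTupleL1_klIsoKernelAt_eq_zero_of_nScales_lt {β : ℝ} (hβ : 0 < β) (U μ : ℝ) (K : TrigPolyC4v) (n : ℕ) {m : ℕ} (hm : nScales β < m)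
    (Ω : Fin 4 → SectorLeg (sectorCount (2 * m))) (x₁ : SpaceTimeIdx L M) :
    fixedTupleL1 L M β 3 (klIsoKernelAt L M β U μ K n m) Ω x₁ = 0 := by
  have he : (0 : ℝ) < klE0 := by norm_num [klE0]
  have h0 : ∀ ω k, klIsoFamily L M β μ K klE0 m ω k = 0 := fun ω k =>
    klIsoFamily_eq_zero_of_klScale_lt he hβ μ K (klth_klScale_lt_pi_div hβ hm) ω k
  refine fixedTupleL1_sectorisedKernel_eq_zero_of_forall β (klIsoKernelAt L M β U μ K n m) Ω (fun x => ?_) x₁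
  show sectorisedKernel L M β (klIsoFamily L M β μ K klE0 m) (klEffectiveAction L M β U μ K klE0 n) 4 Ω x = 0
  rw [sectorisedKernel_def]
  refine sum_eq_zero fun k _ => ?_
  rw [prod_eq_zero (mem_univ (0 : Fin 4)) (by rw [h0, zero_mul]), zero_mul]

end Inactive

/-! ## §2 All patterns, all resolutions, in the regime -/

section Regime

/-- **THE M3 ASSEMBLY IN THE KL REGIME, ALL PATTERNS** (see the module docstring): `∃ A ≥ 1` absolute with
`fixedTupleL1 β 3 (klIsoKernelAt … K n m) Ω x₁ ≤ A·(B + X)` for every `Ω`, `x₁`, `m ≥ 1`, from the `↑↓` value bound `B` on the bare ball and the scale-weighted moment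
budget `X` of the standard tuples (the latter asked only at active resolutions `m ≤ n_β`). -/
theorem fixedTupleL1_klIsoKernelAt_le_regime_allPatterns (ha : (-4 : ℝ) < -(6 / 5)) (hab : (-(6 / 5) : ℝ) ≤ -(1 / 10)) (hb : (-(1 / 10) : ℝ) < 0) :
    ∃ A : ℝ, 1 ≤ A ∧ ∀ (R : RenConsts), (∀ j, 0 ≤ R.Gfr j) →
      ∀ (c U : ℝ), 0 < c →
      c ≤ min (min ((bandBounds ha hab hb).Dtmin / 4) ((bandBounds ha hab hb).rhomin / 4)) (1 / 40) / (12 * (R.Gfr 2 + 1)) → 0 < U →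
      U ≤ min 1 (min (min ((bandBounds ha hab hb).Dtmin / 4) ((bandBounds ha hab hb).rhomin / 4)) (1 / 40) / (24 * (R.Gfr 0 + R.Gfr 1 + 1))) →
      ∀ β : ℝ, klBetaMin ≤ β → β ≤ Real.exp (c / U ^ 2) → ∀ μ ∈ klWindowC, ∀ K : TrigPolyC4v, FrameOK R U (nScales β) μ K →
      ∀ (L M : ℕ) [NeZero L] [NeZero M], β ^ 2 ≤ (L : ℝ) → β ≤ (M : ℝ) → ∀ (n m : ℕ), 1 ≤ m →
      ∀ (B X : ℝ), 0 ≤ B → 0 ≤ X →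
        (∀ k₁ ∈ klBall L μ 0, ∀ k₂ ∈ klBall L μ 0, ∀ k₃ ∈ klBall L μ 0, ‖klQuarticValue L M β U μ K n 0 1 k₁ k₂ k₃‖ ≤ B) →
        (m ≤ nScales β → ∀ (ω : Fin 4 → Fin (sectorCount (2 * m))) (x₁ : SpaceTimeIdx L M) (j : Fin 3),
          klScale klE0 m * (imagTimeWeight β M ^ 3 * ∑ y : Fin 3 → SpaceTimeIdx L M,
            spaceTimeDist L M β x₁ (y j) *
              ‖klIsoKernelAt L M β U μ K n m (fun i => ((ω i, ![(0 : Fin 2), 0, 1, 1] i), ![(0 : Fin 2), 1, 0, 1] i)) (Matrix.vecCons x₁ y)‖) ≤ X) →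
      ∀ (Ω : Fin 4 → SectorLeg (sectorCount (2 * m))) (x₁ : SpaceTimeIdx L M),
        fixedTupleL1 L M β 3 (klIsoKernelAt L M β U μ K n m) Ω x₁ ≤ A * (B + X) := by
  obtain ⟨C, hC, hreg⟩ := fixedTupleL1_klIsoKernelAt_le_regime ha hab hb
  -- `(C(1+Λ)³)³ ≤ 2C³ =: D`; standard tuples `≤ (6D+3)(B+X)`; all patterns `≤ 2(6D+3)(B+X)`
  refine ⟨24 * C ^ 3 + 6, by nlinarith [pow_pos hC 3], ?_⟩
  intro R hR c U hc hcle hU hUle β hβmin hβc μ hμ K hK L M _ _ hLβ hβM n m hm1 B X hB0 hX0 hB hMom Ω x₁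
  have hβ0 : 0 < β := pos_of_klBetaMin_le hβmin
  have he : (0 : ℝ) < klE0 := by norm_num [klE0]
  have hAX : 0 ≤ (24 * C ^ 3 + 6) * (B + X) := by positivity
  by_cases hmN : m ≤ nScales β
  swap
  · rw [fixedTupleL1_klIsoKernelAt_eq_zero_of_nScales_lt hβ0 U μ K n (not_le.mp hmN) Ω x₁]; exact hAX
  -- active resolution: the standard tuples from the regime shape with `ρ := 1`, `Mom := X/Λ_m`
  set Λ : ℝ := klScale klE0 m with hΛdef
  have hΛ0 : 0 < Λ := klth_klScale_pos m
  have hΛsmall : Λ ≤ 1 / 128 := by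
    have h1 : klScale klE0 m ≤ klScale klE0 1 := by
      unfold klScale; exact mul_le_mul_of_nonneg_left (inv_anti₀ (by positivity) (pow_le_pow_right₀ (by norm_num) hm1)) he.le
    have e1 : klScale klE0 1 = 1 / 128 := by unfold klScale klE0; norm_num
    rw [hΛdef]; linarith
  have hπΛ : π / β ≤ Λ := by
    refine (klth_pi_div_le_klScale_nScales hβmin).trans ?_
    rw [hΛdef]; unfold klScale
    exact mul_le_mul_of_nonneg_left (inv_anti₀ (by positivity) (pow_le_pow_right₀ (by norm_num) hmN)) he.le
  have hstd : ∀ (ω : Fin 4 → Fin (sectorCount (2 * m))) (x : SpaceTimeIdx L M),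
      fixedTupleL1 L M β 3 (klIsoKernelAt L M β U μ K n m) (fun i => ((ω i, ![(0 : Fin 2), 0, 1, 1] i), ![(0 : Fin 2), 1, 0, 1] i)) x ≤
        (12 * C ^ 3 + 3) * (B + X) := by
    intro ω x
    have hMomx : ∀ j : Fin 3, imagTimeWeight β M ^ 3 * ∑ y : Fin 3 → SpaceTimeIdx L M,
        spaceTimeDist L M β x (y j) *
          ‖klIsoKernelAt L M β U μ K n m (fun i => ((ω i, ![(0 : Fin 2), 0, 1, 1] i), ![(0 : Fin 2), 1, 0, 1] i)) (Matrix.vecCons x y)‖ ≤ X / Λ := by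
      intro j
      rw [le_div_iff₀ hΛ0, mul_comm]
      exact hMom hmN ω x j
    have h := hreg R hR c U hc hcle hU hUle β hβmin hβc μ hμ K hK L M hLβ hβM n m hm1 hmN
      (fun i => ((ω i, ![(0 : Fin 2), 0, 1, 1] i), ![(0 : Fin 2), 1, 0, 1] i)) rfl rfl rfl rfl rfl rfl rfl rfl x 1 B (X / Λ) one_pos hB0 hB hMomx
    rw [← hΛdef] at h
    refine h.trans ?_
    -- arithmetic: `(C(1+Λ)³)³ ≤ 2C³`, `(Λ + π/β)·3·(X/Λ) ≤ 6X`, `3·(X/Λ)·Λ/1 = 3X`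
    have h19 : (1 + Λ) ^ 9 ≤ 2 := by
      have h2 : (1 + Λ) ^ 9 ≤ (1 + 1 / 128) ^ 9 := pow_le_pow_left₀ (by linarith) (by linarith) 9
      exact h2.trans (by norm_num)
    have hD : (C * (1 + Λ) ^ 3) ^ 3 ≤ 2 * C ^ 3 := by
      rw [mul_pow, ← pow_mul]; norm_num
      nlinarith [pow_pos hC 3]
    have hD0 : 0 ≤ (C * (1 + Λ) ^ 3) ^ 3 := by positivity
    have e3 : 3 * (X / Λ) * Λ / 1 = 3 * X := by field_simp
    have hmid : (Λ + π / β) * (3 * (X / Λ)) ≤ 6 * X := by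
      have : (Λ + π / β) * (3 * (X / Λ)) ≤ (2 * Λ) * (3 * (X / Λ)) :=
        mul_le_mul_of_nonneg_right (by linarith) (by positivity)
      refine this.trans (le_of_eq ?_)
      field_simp; ring
    have hin : B / 24 + (Λ + π / β) * (3 * (X / Λ)) ≤ B + 6 * X := by
      have : B / 24 ≤ B := by linarith
      linarith
    have hin0 : 0 ≤ B / 24 + (Λ + π / β) * (3 * (X / Λ)) := by positivity
    rw [e3]
    calc (C * (1 + Λ) ^ 3) ^ 3 * (B / 24 + (Λ + π / β) * (3 * (X / Λ))) + 3 * X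
        ≤ 2 * C ^ 3 * (B + 6 * X) + 3 * X := by
          have := mul_le_mul hD hin hin0 (by positivity)
          linarith
      _ ≤ (12 * C ^ 3 + 3) * (B + X) := by nlinarith [pow_pos hC 3]
  have h2 := fixedTupleL1_klIsoKernelAt_le_two_mul_of_std hβ0 U μ K n m (S := (12 * C ^ 3 + 3) * (B + X)) (by positivity) hstd Ω x₁
  linarith

end Regime

/-! ## §3 Under the engine's stub binders -/

section Tokens

/-- **THE M3 ASSEMBLY UNDER THE STUB BINDERS** (`R.WF2`, `c ≤ klEngC₃3 P R`, `U ≤ klEngU₀3 P R c`, `klEngL₃ β U ≤ L`, `klEngM₃ β U L ≤ M`; any admissible frame `K`,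
any kernel scale `n`, resolution `m ≥ 1`): `∃ A ≥ 1` absolute, `fixedTupleL1 β 3 (klIsoKernelAt … K n m) Ω x₁ ≤ A·(B + X)` for every `Ω`, `x₁` from the value bound `B` and the
moment budget `X` of §2.  Holders of the v2 tokens use `klEngC₃6_le_klEngC₃3`, `klEngU₀10_le_klEngU₀3`, `klEngL₃_le_of_klEngL₄_le`. -/
theorem fixedTupleL1_klIsoKernelAt_le_valueMoments_klEng :
    ∃ A : ℝ, 1 ≤ A ∧ ∀ (P : SplitConsts) (R : RenConsts) (c : ℝ), R.WF2 → 0 < c → c ≤ klEngC₃3 P R →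
      ∀ μ ∈ klWindowC, ∀ U : ℝ, 0 < U → U ≤ klEngU₀3 P R c → ∀ β : ℝ, klBetaMin ≤ β → β ≤ Real.exp (c / U ^ 2) →
      ∀ K : TrigPolyC4v, FrameOK R U (nScales β) μ K → ∀ (L M : ℕ) [NeZero L] [NeZero M], klEngL₃ β U ≤ L → klEngM₃ β U L ≤ M →
      ∀ (n m : ℕ), 1 ≤ m → ∀ (B X : ℝ), 0 ≤ B → 0 ≤ X →
        (∀ k₁ ∈ klBall L μ 0, ∀ k₂ ∈ klBall L μ 0, ∀ k₃ ∈ klBall L μ 0, ‖klQuarticValue L M β U μ K n 0 1 k₁ k₂ k₃‖ ≤ B) →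
        (m ≤ nScales β → ∀ (ω : Fin 4 → Fin (sectorCount (2 * m))) (x₁ : SpaceTimeIdx L M) (j : Fin 3),
          klScale klE0 m * (imagTimeWeight β M ^ 3 * ∑ y : Fin 3 → SpaceTimeIdx L M,
            spaceTimeDist L M β x₁ (y j) *
              ‖klIsoKernelAt L M β U μ K n m (fun i => ((ω i, ![(0 : Fin 2), 0, 1, 1] i), ![(0 : Fin 2), 1, 0, 1] i)) (Matrix.vecCons x₁ y)‖) ≤ X) →
      ∀ (Ω : Fin 4 → SectorLeg (sectorCount (2 * m))) (x₁ : SpaceTimeIdx L M),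
        fixedTupleL1 L M β 3 (klIsoKernelAt L M β U μ K n m) Ω x₁ ≤ A * (B + X) := by
  have ha : (-4 : ℝ) < -(6 / 5) := by norm_num
  have hab : (-(6 / 5) : ℝ) ≤ -(1 / 10) := by norm_num
  have hb : (-(1 / 10) : ℝ) < 0 := by norm_num
  obtain ⟨A, hA, h⟩ := fixedTupleL1_klIsoKernelAt_le_regime_allPatterns ha hab hb
  refine ⟨A, hA, ?_⟩
  intro P R c hR2 hc hc3 μ hμ U hU hU3 β hβmin hβc K hK L M _ _ hL3 hM3 n m hm1 B X hB0 hX0 hB hMom Ω x₁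
  have hRj : ∀ j, 0 ≤ R.Gfr j := gfr_nonneg_of_wf2 hR2
  exact h R hRj c U hc (hc3.trans (klEngC₃3_le_symbolC₃ ha hab hb P hRj)) hU (hU3.trans (klEngU₀3_le_symbolU₀ ha hab hb P hRj c)) β hβmin hβc μ hμ
    K hK L M (sq_le_of_klEngL₃_le hL3) (le_of_klEngM₃_le hβmin hL3 hM3) n m hm1 B X hB0 hX0 hB hMom Ω x₁

end Tokens

/-! ## §4 Packagings: the class-#6 text `IsoTupleLineAt`, and (E5-F)ₙ by B-absorption -/

section Packaging

/-- **`IsoTupleLineAt` FROM A VALUE LINE AND A MOMENT LINE** (stub binders; `K := K_n = klFlowFrameU … n`, `1 ≤ n`): `∃ A ≥ 1` absolute such that an outright value line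
`‖λ_n[K_n](k₁,k₂,k₃)‖ ≤ c_B·U` on the bare ball and the moment line `Λ_m·Mom_j(Ω_std, x₁) ≤ c_M·U + c_M′·(Klam U)²` at the active resolutions `n ≤ m ≤ n_β` give
`IsoTupleLineAt L M (A·(c_B + c_M)) (A·c_M′) P β U μ n`. -/
theorem isoTupleLineAt_of_valueLine_momentLine :
    ∃ A : ℝ, 1 ≤ A ∧ ∀ (P : SplitConsts) (R : RenConsts) (c : ℝ), R.WF2 → 0 < c → c ≤ klEngC₃3 P R →
      ∀ μ ∈ klWindowC, ∀ U : ℝ, 0 < U → U ≤ klEngU₀3 P R c → ∀ β : ℝ, klBetaMin ≤ β → β ≤ Real.exp (c / U ^ 2) →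
      ∀ (L M : ℕ) [NeZero L] [NeZero M], klEngL₃ β U ≤ L → klEngM₃ β U L ≤ M → ∀ n : ℕ, 1 ≤ n →
      FrameOK R U (nScales β) μ (klFlowFrameU L M β U μ n) → ∀ (cB cM cM' : ℝ), 0 ≤ cB → 0 ≤ cM → 0 ≤ cM' →
        (∀ k₁ ∈ klBall L μ 0, ∀ k₂ ∈ klBall L μ 0, ∀ k₃ ∈ klBall L μ 0,
          ‖klQuarticValue L M β U μ (klFlowFrameU L M β U μ n) n 0 1 k₁ k₂ k₃‖ ≤ cB * U) →
        (∀ m : ℕ, n ≤ m → m ≤ nScales β → ∀ (ω : Fin 4 → Fin (sectorCount (2 * m))) (x₁ : SpaceTimeIdx L M) (j : Fin 3),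
          klScale klE0 m * (imagTimeWeight β M ^ 3 * ∑ y : Fin 3 → SpaceTimeIdx L M,
            spaceTimeDist L M β x₁ (y j) *
              ‖klIsoKernelAt L M β U μ (klFlowFrameU L M β U μ n) n m (fun i => ((ω i, ![(0 : Fin 2), 0, 1, 1] i), ![(0 : Fin 2), 1, 0, 1] i))
                (Matrix.vecCons x₁ y)‖) ≤ cM * U + cM' * (P.Klam * U) ^ 2) →
      IsoTupleLineAt L M (A * (cB + cM)) (A * cM') P β U μ n := by
  obtain ⟨A, hA, h⟩ := fixedTupleL1_klIsoKernelAt_le_valueMoments_klEng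
  refine ⟨A, hA, ?_⟩
  intro P R c hR2 hc hc3 μ hμ U hU hU3 β hβmin hβc L M _ _ hL3 hM3 n hn1 hK cB cM cM' hcB hcM hcM' hval hmom m hnm Ω _ x₁
  have hm1 : 1 ≤ m := hn1.trans hnm
  have hB0 : 0 ≤ cB * U := mul_nonneg hcB hU.le
  have hX0 : 0 ≤ cM * U + cM' * (P.Klam * U) ^ 2 := by positivity
  have hb := h P R c hR2 hc hc3 μ hμ U hU hU3 β hβmin hβc (klFlowFrameU L M β U μ n) hK L M hL3 hM3 n m hm1 (cB * U)
    (cM * U + cM' * (P.Klam * U) ^ 2) hB0 hX0 hval (fun hmN => hmom m hnm hmN) Ω x₁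
  refine hb.trans (le_of_eq ?_)
  ring

variable {L M : ℕ} [NeZero L] [NeZero M]

/-- **B-absorption in the `∀ B` form**: a three-constant line `fixedTupleL1 ≤ A·B + (a′·U + b′·(Klam U)²)` for every admissible value bound `B`, one value lower bound
`θ·U ≤ ‖λ_n[K_n](k₁,k₂,k₃)‖` on the bare ball (`0 < θ`), and the fits `A + a′/θ ≤ CF`, `b′ ≤ CF` give `IsoTupleL1AtV17F … n`. -/
theorem isoTupleL1AtV17F_of_threeConst_le {G : GeoConsts} {P : SplitConsts} {β U μ : ℝ} {n : ℕ} {A a' b' θ : ℝ}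
    (hθ : 0 < θ) (ha' : 0 ≤ a')
    (hfix : ∀ B : ℝ, 0 ≤ B →
      (∀ k₁ ∈ klBall L μ 0, ∀ k₂ ∈ klBall L μ 0, ∀ k₃ ∈ klBall L μ 0, ‖klQuarticValue L M β U μ (klFlowFrameU L M β U μ n) n 0 1 k₁ k₂ k₃‖ ≤ B) →
      ∀ m : ℕ, n ≤ m → ∀ Ω ∈ bgmSectorSet L M (klIsoFamily L M β μ (klFlowFrameU L M β U μ n) klE0 m) 4, ∀ x₁ : SpaceTimeIdx L M,
        fixedTupleL1 L M β 3 (klIsoKernelAt L M β U μ (klFlowFrameU L M β U μ n) n m) Ω x₁ ≤ A * B + (a' * U + b' * (P.Klam * U) ^ 2))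
    {k₁ k₂ k₃ : TorusSite 2 L} (hk₁ : k₁ ∈ klBall L μ 0) (hk₂ : k₂ ∈ klBall L μ 0) (hk₃ : k₃ ∈ klBall L μ 0)
    (hlow : θ * U ≤ ‖klQuarticValue L M β U μ (klFlowFrameU L M β U μ n) n 0 1 k₁ k₂ k₃‖)
    (hfitA : A + a' / θ ≤ G.CF) (hfitb : b' ≤ G.CF) :
    IsoTupleL1AtV17F L M G P β U μ n := by
  intro B hB0 hvals m hm Ω hΩ x₁
  have hθB : θ * U ≤ B := hlow.trans (hvals k₁ hk₁ k₂ hk₂ k₃ hk₃)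
  have h1 := hfix B hB0 hvals m hm Ω hΩ x₁
  have hsq : 0 ≤ (P.Klam * U) ^ 2 := sq_nonneg _
  have h2 : a' * U ≤ a' / θ * B := by
    rw [div_mul_eq_mul_div, le_div_iff₀ hθ]
    calc a' * U * θ = a' * (θ * U) := by ring
      _ ≤ a' * B := mul_le_mul_of_nonneg_left hθB ha'
  have h3 : A * B + a' / θ * B ≤ G.CF * B := by
    rw [← add_mul]; exact mul_le_mul_of_nonneg_right hfitA hB0
  have h4 : b' * (P.Klam * U) ^ 2 ≤ G.CF * (P.Klam * U) ^ 2 := mul_le_mul_of_nonneg_right hfitb hsq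
  linarith

/-- **(E5-F)ₙ FROM THE MOMENT LINE AND ONE VALUE LOWER BOUND** (stub binders; `1 ≤ n`): `∃ A ≥ 1` absolute such that the moment line `Λ_m·Mom_j ≤ c_M·U + c_M′·(Klam U)²`
(`n ≤ m ≤ n_β`, standard tuples), a value lower bound `θ·U ≤ ‖λ_n[K_n](k₁,k₂,k₃)‖` at one bare-ball triple, and the fits `A·(1 + c_M/θ) ≤ CF`, `A·c_M′ ≤ CF` give
`IsoTupleL1AtV17F L M G P β U μ n` — the value bound `B` is the consumer's, the U-linear moment part is absorbed by `B ≥ θ·U`. -/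
theorem isoTupleL1AtV17F_of_momentLine_of_lowValue :
    ∃ A : ℝ, 1 ≤ A ∧ ∀ (G : GeoConsts) (P : SplitConsts) (R : RenConsts) (c : ℝ), R.WF2 → 0 < c → c ≤ klEngC₃3 P R →
      ∀ μ ∈ klWindowC, ∀ U : ℝ, 0 < U → U ≤ klEngU₀3 P R c → ∀ β : ℝ, klBetaMin ≤ β → β ≤ Real.exp (c / U ^ 2) →
      ∀ (L M : ℕ) [NeZero L] [NeZero M], klEngL₃ β U ≤ L → klEngM₃ β U L ≤ M → ∀ n : ℕ, 1 ≤ n →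
      FrameOK R U (nScales β) μ (klFlowFrameU L M β U μ n) → ∀ (cM cM' θ : ℝ), 0 ≤ cM → 0 ≤ cM' → 0 < θ →
        A * (1 + cM / θ) ≤ G.CF → A * cM' ≤ G.CF →
        (∀ m : ℕ, n ≤ m → m ≤ nScales β → ∀ (ω : Fin 4 → Fin (sectorCount (2 * m))) (x₁ : SpaceTimeIdx L M) (j : Fin 3),
          klScale klE0 m * (imagTimeWeight β M ^ 3 * ∑ y : Fin 3 → SpaceTimeIdx L M,
            spaceTimeDist L M β x₁ (y j) *
              ‖klIsoKernelAt L M β U μ (klFlowFrameU L M β U μ n) n m (fun i => ((ω i, ![(0 : Fin 2), 0, 1, 1] i), ![(0 : Fin 2), 1, 0, 1] i))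
                (Matrix.vecCons x₁ y)‖) ≤ cM * U + cM' * (P.Klam * U) ^ 2) →
        ∀ (k₁ k₂ k₃ : TorusSite 2 L), k₁ ∈ klBall L μ 0 → k₂ ∈ klBall L μ 0 → k₃ ∈ klBall L μ 0 →
          θ * U ≤ ‖klQuarticValue L M β U μ (klFlowFrameU L M β U μ n) n 0 1 k₁ k₂ k₃‖ →
      IsoTupleL1AtV17F L M G P β U μ n := by
  obtain ⟨A, hA, h⟩ := fixedTupleL1_klIsoKernelAt_le_valueMoments_klEng
  refine ⟨A, hA, ?_⟩
  intro G P R c hR2 hc hc3 μ hμ U hU hU3 β hβmin hβc L M _ _ hL3 hM3 n hn1 hK cM cM' θ hcM hcM' hθ hfitA hfitb hmom k₁ k₂ k₃ hk₁ hk₂ hk₃ hlow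
  have hA0 : 0 ≤ A := le_trans zero_le_one hA
  refine isoTupleL1AtV17F_of_threeConst_le (A := A) (a' := A * cM) (b' := A * cM') hθ (mul_nonneg hA0 hcM) ?_ hk₁ hk₂ hk₃ hlow
    (by rw [mul_div_assoc, ← mul_one_add]; exact hfitA) hfitb
  intro B hB0 hvals m hnm Ω _ x₁
  have hm1 : 1 ≤ m := hn1.trans hnm
  have hX0 : 0 ≤ cM * U + cM' * (P.Klam * U) ^ 2 := by positivity
  have hb := h P R c hR2 hc hc3 μ hμ U hU hU3 β hβmin hβc (klFlowFrameU L M β U μ n) hK L M hL3 hM3 n m hm1 B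
    (cM * U + cM' * (P.Klam * U) ^ 2) hB0 hX0 hvals (fun hmN => hmom m hnm hmN) Ω x₁
  refine hb.trans (le_of_eq ?_)
  ring

end Packaging

/-! ## §5 The (X).2 conjunct modulo the value line, the moment line and the fit -/

section Closer

/-- **(X).2 FROM A VALUE LINE + A MOMENT LINE + THE FIT** (any `CF`, any table `Q`, any threshold `u` with `0 < u cc`): `∃ A ≥ 1` absolute such that, if under the
W-Step's binders (`klEngC₃6`, `klEngU₀10`, `u cc`, `klEngL₄`, `klEngM₃`, `1 ≤ n ≤ n_β + 1`, `IsKLRegime`, `FrameOK K_n`) the value line `‖λ_n[K_n]‖ ≤ c_B·U` on the bare ball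
and the moment line `Λ_m·Mom_j(Ω_std, x₁) ≤ c_M·U + c_M′·(Klam U)²` (`n ≤ m ≤ n_β`) hold, and the package `(A(c_B + c_M), A c_M′, u)` FITS
(`max (A(c_B+c_M)) (T̂⁴/2) + max (A c_M′) (T̂⁴·V₀/192)·Klam²·u cc ≤ CF/2`), then `∃ e, IsIsoPkgW P CF e ∧ IsoTupleLineStepW P R Q e.1 e.2.1 e.2.2`
(`exists_isoPkgW_of_isoLine` ∘ §4). -/
theorem exists_isoPkgW_of_valueLine_momentLine :
    ∃ A : ℝ, 1 ≤ A ∧ ∀ (P : SplitConsts) (R : RenConsts), P.WF → R.WF2 → ∀ (Q : EngConsts) (CF cB cM cM' : ℝ) (u : ℝ → ℝ),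
      0 ≤ cB → 0 ≤ cM → 0 ≤ cM' → (∀ cc, 0 < u cc) →
      (∀ cc, max (A * (cB + cM)) (klIsoT ^ 4 / 2) + max (A * cM') (klIsoT ^ 4 * klScaleZeroValC R / 192) * P.Klam ^ 2 * u cc ≤ CF / 2) →
      (∀ cc : ℝ, 0 < cc → cc ≤ klEngC₃6 P R → ∀ μ ∈ klWindowC, ∀ U : ℝ, 0 < U → U ≤ klEngU₀10 P R cc → U ≤ u cc →
        ∀ β : ℝ, klBetaMin ≤ β → β ≤ Real.exp (cc / U ^ 2) → ∀ (L M : ℕ) [NeZero L] [NeZero M], klEngL₄ P R β U ≤ L → klEngM₃ β U L ≤ M →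
        ∀ n : ℕ, 1 ≤ n → n ≤ nScales β + 1 → IsKLRegime U cc (-(n : ℤ)) → FrameOK R U (nScales β) μ (klFlowFrameU L M β U μ n) →
        (∀ k₁ ∈ klBall L μ 0, ∀ k₂ ∈ klBall L μ 0, ∀ k₃ ∈ klBall L μ 0,
            ‖klQuarticValue L M β U μ (klFlowFrameU L M β U μ n) n 0 1 k₁ k₂ k₃‖ ≤ cB * U) ∧
          (∀ m : ℕ, n ≤ m → m ≤ nScales β → ∀ (ω : Fin 4 → Fin (sectorCount (2 * m))) (x₁ : SpaceTimeIdx L M) (j : Fin 3),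
            klScale klE0 m * (imagTimeWeight β M ^ 3 * ∑ y : Fin 3 → SpaceTimeIdx L M,
              spaceTimeDist L M β x₁ (y j) *
                ‖klIsoKernelAt L M β U μ (klFlowFrameU L M β U μ n) n m (fun i => ((ω i, ![(0 : Fin 2), 0, 1, 1] i), ![(0 : Fin 2), 1, 0, 1] i))
                  (Matrix.vecCons x₁ y)‖) ≤ cM * U + cM' * (P.Klam * U) ^ 2)) →
      ∃ e : ℝ × ℝ × (ℝ → ℝ), IsIsoPkgW P CF e ∧ IsoTupleLineStepW P R Q e.1 e.2.1 e.2.2 := by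
  obtain ⟨A, hA, h⟩ := isoTupleLineAt_of_valueLine_momentLine
  refine ⟨A, hA, ?_⟩
  intro P R hP hR2 Q CF cB cM cM' u hcB hcM hcM' hupos hfit hdata
  refine exists_isoPkgW_of_isoLine P R hP hR2 Q hupos hfit ?_
  intro cc hcc hcc6 μ hμ U hU hU10 hUu β hβ hβc L M _ _ hL hM n hn1 hn hreg hK
  obtain ⟨hval, hmom⟩ := hdata cc hcc hcc6 μ hμ U hU hU10 hUu β hβ hβc L M hL hM n hn1 hn hreg hK
  exact h P R cc hR2 hcc (hcc6.trans (klEngC₃6_le_klEngC₃3 P R)) μ hμ U hU (hU10.trans (klEngU₀10_le_klEngU₀3 P R cc)) β hβ hβc L M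
    (klEngL₃_le_of_klEngL₄_le hL) hM n hn1 hK cB cM cM' hcB hcM hcM' hval hmom

end Closer

/-! ## §6 (appended) The near radius `ρ` kept free — separate coefficients for the value and the moments ((R1) tuning) -/

/-- **THE M3 ASSEMBLY WITH A FREE NEAR RADIUS** (symbol-layer thresholds; all patterns; `m ≥ 1`): `∃ C > 0` absolute (the near coefficient of
`fixedTupleL1_klIsoKernelAt_le_regime`) such that for every `ρ > 0`,
`fixedTupleL1 β 3 (klIsoKernelAt … K n m) Ω x₁ ≤ 2·((C·(ρ + 1/128)³)³·(B/24 + 6·X) + 3·X/ρ)` — the value coefficient scales like `ρ⁹`, the far moment coefficient like `1/ρ`. -/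
theorem fixedTupleL1_klIsoKernelAt_le_regime_allPatterns_rho (ha : (-4 : ℝ) < -(6 / 5)) (hab : (-(6 / 5) : ℝ) ≤ -(1 / 10)) (hb : (-(1 / 10) : ℝ) < 0) :
    ∃ C : ℝ, 0 < C ∧ ∀ (R : RenConsts), (∀ j, 0 ≤ R.Gfr j) →
      ∀ (c U : ℝ), 0 < c →
      c ≤ min (min ((bandBounds ha hab hb).Dtmin / 4) ((bandBounds ha hab hb).rhomin / 4)) (1 / 40) / (12 * (R.Gfr 2 + 1)) → 0 < U →
      U ≤ min 1 (min (min ((bandBounds ha hab hb).Dtmin / 4) ((bandBounds ha hab hb).rhomin / 4)) (1 / 40) / (24 * (R.Gfr 0 + R.Gfr 1 + 1))) →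
      ∀ β : ℝ, klBetaMin ≤ β → β ≤ Real.exp (c / U ^ 2) → ∀ μ ∈ klWindowC, ∀ K : TrigPolyC4v, FrameOK R U (nScales β) μ K →
      ∀ (L M : ℕ) [NeZero L] [NeZero M], β ^ 2 ≤ (L : ℝ) → β ≤ (M : ℝ) → ∀ (n m : ℕ), 1 ≤ m →
      ∀ (ρ B X : ℝ), 0 < ρ → 0 ≤ B → 0 ≤ X →
        (∀ k₁ ∈ klBall L μ 0, ∀ k₂ ∈ klBall L μ 0, ∀ k₃ ∈ klBall L μ 0, ‖klQuarticValue L M β U μ K n 0 1 k₁ k₂ k₃‖ ≤ B) →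
        (m ≤ nScales β → ∀ (ω : Fin 4 → Fin (sectorCount (2 * m))) (x₁ : SpaceTimeIdx L M) (j : Fin 3),
          klScale klE0 m * (imagTimeWeight β M ^ 3 * ∑ y : Fin 3 → SpaceTimeIdx L M,
            spaceTimeDist L M β x₁ (y j) *
              ‖klIsoKernelAt L M β U μ K n m (fun i => ((ω i, ![(0 : Fin 2), 0, 1, 1] i), ![(0 : Fin 2), 1, 0, 1] i)) (Matrix.vecCons x₁ y)‖) ≤ X) →
      ∀ (Ω : Fin 4 → SectorLeg (sectorCount (2 * m))) (x₁ : SpaceTimeIdx L M),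
        fixedTupleL1 L M β 3 (klIsoKernelAt L M β U μ K n m) Ω x₁ ≤ 2 * ((C * (ρ + 1 / 128) ^ 3) ^ 3 * (B / 24 + 6 * X) + 3 * X / ρ) := by
  obtain ⟨C, hC, hreg⟩ := fixedTupleL1_klIsoKernelAt_le_regime ha hab hb
  refine ⟨C, hC, ?_⟩
  intro R hR c U hc hcle hU hUle β hβmin hβc μ hμ K hK L M _ _ hLβ hβM n m hm1 ρ B X hρ hB0 hX0 hB hMom Ω x₁
  have hβ0 : 0 < β := pos_of_klBetaMin_le hβmin
  have he : (0 : ℝ) < klE0 := by norm_num [klE0]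
  have hrhs0 : 0 ≤ (C * (ρ + 1 / 128) ^ 3) ^ 3 * (B / 24 + 6 * X) + 3 * X / ρ := by positivity
  by_cases hmN : m ≤ nScales β
  swap
  · rw [fixedTupleL1_klIsoKernelAt_eq_zero_of_nScales_lt hβ0 U μ K n (not_le.mp hmN) Ω x₁]; positivity
  set Λ : ℝ := klScale klE0 m with hΛdef
  have hΛ0 : 0 < Λ := klth_klScale_pos m
  have hΛsmall : Λ ≤ 1 / 128 := by
    have h1 : klScale klE0 m ≤ klScale klE0 1 := by
      unfold klScale; exact mul_le_mul_of_nonneg_left (inv_anti₀ (by positivity) (pow_le_pow_right₀ (by norm_num) hm1)) he.le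
    have e1 : klScale klE0 1 = 1 / 128 := by unfold klScale klE0; norm_num
    rw [hΛdef]; linarith
  have hπΛ : π / β ≤ Λ := by
    refine (klth_pi_div_le_klScale_nScales hβmin).trans ?_
    rw [hΛdef]; unfold klScale
    exact mul_le_mul_of_nonneg_left (inv_anti₀ (by positivity) (pow_le_pow_right₀ (by norm_num) hmN)) he.le
  have hstd : ∀ (ω : Fin 4 → Fin (sectorCount (2 * m))) (x : SpaceTimeIdx L M),
      fixedTupleL1 L M β 3 (klIsoKernelAt L M β U μ K n m) (fun i => ((ω i, ![(0 : Fin 2), 0, 1, 1] i), ![(0 : Fin 2), 1, 0, 1] i)) x ≤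
        (C * (ρ + 1 / 128) ^ 3) ^ 3 * (B / 24 + 6 * X) + 3 * X / ρ := by
    intro ω x
    have hMomx : ∀ j : Fin 3, imagTimeWeight β M ^ 3 * ∑ y : Fin 3 → SpaceTimeIdx L M,
        spaceTimeDist L M β x (y j) *
          ‖klIsoKernelAt L M β U μ K n m (fun i => ((ω i, ![(0 : Fin 2), 0, 1, 1] i), ![(0 : Fin 2), 1, 0, 1] i)) (Matrix.vecCons x y)‖ ≤ X / Λ := by
      intro j
      rw [le_div_iff₀ hΛ0, mul_comm]
      exact hMom hmN ω x j
    have h := hreg R hR c U hc hcle hU hUle β hβmin hβc μ hμ K hK L M hLβ hβM n m hm1 hmN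
      (fun i => ((ω i, ![(0 : Fin 2), 0, 1, 1] i), ![(0 : Fin 2), 1, 0, 1] i)) rfl rfl rfl rfl rfl rfl rfl rfl x ρ B (X / Λ) hρ hB0 hB hMomx
    rw [← hΛdef] at h
    refine h.trans ?_
    have hcoef : (C * (ρ + Λ) ^ 3) ^ 3 ≤ (C * (ρ + 1 / 128) ^ 3) ^ 3 := by
      have h1 : (ρ + Λ) ^ 3 ≤ (ρ + 1 / 128) ^ 3 := pow_le_pow_left₀ (by linarith) (by linarith) 3
      exact pow_le_pow_left₀ (by positivity) (mul_le_mul_of_nonneg_left h1 hC.le) 3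
    have e3 : 3 * (X / Λ) * Λ / ρ = 3 * X / ρ := by field_simp
    have hmid : (Λ + π / β) * (3 * (X / Λ)) ≤ 6 * X := by
      have : (Λ + π / β) * (3 * (X / Λ)) ≤ (2 * Λ) * (3 * (X / Λ)) :=
        mul_le_mul_of_nonneg_right (by linarith) (by positivity)
      refine this.trans (le_of_eq ?_)
      field_simp; ring
    rw [e3]
    have := mul_le_mul hcoef (by linarith : B / 24 + (Λ + π / β) * (3 * (X / Λ)) ≤ B / 24 + 6 * X) (by positivity) (by positivity)
    linarith
  have h2 := fixedTupleL1_klIsoKernelAt_le_two_mul_of_std hβ0 U μ K n m (S := (C * (ρ + 1 / 128) ^ 3) ^ 3 * (B / 24 + 6 * X) + 3 * X / ρ) hrhs0 hstd Ω x₁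
  linarith

end Summit.HubbardSuperconductivity.HubbardSuperconductivity.Theorems.EngineV8

end
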